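import Summits.QuantumAdvantage.QuantumAdvantage.Theses.CubicForrelation
import Literature.Computability.QuantumComplexity.ForrelationSignTransport
import Literature.Computability.QuantumComplexity.ForrelationDirectSum

/-!
# Crux `CubicForrelation.ExactPairsMaioranaMcFarland` (stmt-QuantumAdvantage-2205) — toward stub `stub_defect_vanishing`, III: Carlet moves

Line `two-adic-local-nongeneric`, stub `stub_defect_vanishing` (the β-half / DEFECT FORM): for an exact cubic pair
(`f`, `g` cubic on `m + m` bits, `g` bent with dual `f`: `W_g = 2^m (-1)^f`) that has an `m`-dimensional SINGULAR
subspace `V` of the cubic form of `g` (all second derivatives `D_a D_b g`, `a b ∈ V`, CONSTANT in `x`), some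
`m`-dimensional `V′` should carry VANISHING second derivatives (Dillon's criterion).  That statement is open
mathematics (implied by the crux; no proof known for `m ≥ 5`) and is NOT proved here; this is one of four `dv_`
helper files (`…DefectVanishing`, `…DefectVanishingDillonDual`, `…DefectVanishingCarlet`,
`…DefectVanishingSmallCases`) landing the provable structure around it, in the crux's definition-free vocabulary
(second derivatives as 4-fold xors `g x ⊕ g (x ⊕ a) ⊕ g (x ⊕ b) ⊕ g (x ⊕ a ⊕ b)`, subspaces as xor-closed finsets of
size `2^k`).

This file: CARLET MOVES `g ↦ g ⊕ ℓ_a ℓ_b` (mechanism (iii); C. Carlet, Two new classes of bent functions,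
EUROCRYPT '93, LNCS 765; *Boolean Functions for Cryptography and Coding Theory* (CUP 2021), §6.1).  For `g` on `n`
bits with `W_g = c·(-1)^f` and `ℓ_a, ℓ_b` Boolean with `(-1)^{ℓ_a(x)} = (-1)^{x·a}` (they exist:
`dv_exists_linear_bool`; they are additive: `dv_linear_of_signOf_eq_twist`):
* `2·W_{g ⊕ ℓ_a ℓ_b}(u) = W_g(u) + W_g(u ⊕ a) + W_g(u ⊕ b) - W_g(u ⊕ a ⊕ b)` (`dv_carlet_W`);
* if `D_a D_b f ≡ 0` then `W_{g ⊕ ℓ_a ℓ_b} = c·(-1)^{f ⊕ (D_a f)(D_b f)}` — the moved function is again bent, with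
  dual `f ⊕ (D_a f)(D_b f)` (`dv_carlet_move`); conversely `W_{g ⊕ ℓ_a ℓ_b}(u)² = c² ≠ 0` forces
  `D_a D_b f (u) = 0` (`dv_carlet_converse`);
* the move shifts EVERY second derivative by the constant `ℓ_a(v)ℓ_b(w) ⊕ ℓ_a(w)ℓ_b(v)` (`dv_d2_carlet`): singular
  subspaces of the cubic form stay singular and the defect form changes by the alternating form `a ∧ b`.

What is NOT here: the stub (open for `m ≥ 3`) and the other helper files of the series.  Everything is proved from
the tree (`ForrelationDerivativeTables`, `ForrelationDirectSum.signOf_xor`) and Mathlib; no named facts.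
-/

set_option linter.dupNamespace false -- D-0017: single-problem summit ⇒ `QuantumAdvantage.QuantumAdvantage` by design

namespace Summit.QuantumAdvantage.QuantumAdvantage.Theorems.CubicForrelation.ExactPairsMaioranaMcFarland

open Finset
open Literature.Computability.QuantumComplexity
open Literature.Computability.QuantumComplexity.BuzetChailloux (bxor)
open Literature.Computability.QuantumComplexity.BuzetChailloux (zeroVec bxor_self twist_bxor_right)
open Literature.Computability.QuantumComplexity.Simon (twist_eq_one_or)
open Literature.Computability.QuantumComplexity.DerivativeWalsh (twist_bxor_left)

/-! ### Carlet moves `g ↦ g ⊕ ℓ_a ℓ_b` (mechanism (iii)) -/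

/-- `signOf` is injective. -/
theorem dv_signOf_injective {p q : Bool} (h : signOf p = signOf q) : p = q := by
  revert h
  cases p <;> cases q <;> norm_num [signOf]

/-- `2 (-1)^{p ∧ q} = 1 + (-1)^p + (-1)^q - (-1)^p (-1)^q`. -/
theorem dv_two_mul_signOf_and (p q : Bool) :
    2 * signOf (p && q) = 1 + signOf p + signOf q - signOf p * signOf q := by
  cases p <;> cases q <;> norm_num [signOf]

/-- The three-sign identity behind the dual of a Carlet move:
`(-1)^p + (-1)^q + (-1)^r - (-1)^{p+q+r} = 2 (-1)^{p ⊕ (p ⊕ q)(p ⊕ r)}`. -/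
theorem dv_carlet_signs (p q r : Bool) :
    signOf p + signOf q + signOf r - signOf p * signOf q * signOf r =
      2 * signOf (p ^^ ((p ^^ q) && (p ^^ r))) := by
  cases p <;> cases q <;> cases r <;> norm_num [signOf]

/-- The linear Boolean function `ℓ_a(x) = a·x` exists as a `Bool`-valued function: `(-1)^{ℓ_a(x)} = (-1)^{x·a}`. -/
theorem dv_exists_linear_bool {n : ℕ} (a : Fin n → Bool) :
    ∃ la : (Fin n → Bool) → Bool, ∀ x, signOf (la x) = twist x a := by
  refine ⟨fun x => decide (twist x a = -1), fun x => ?_⟩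
  show signOf (decide (twist x a = -1)) = twist x a
  rcases twist_eq_one_or x a with h | h
  · have hd : decide (twist x a = -1) = false := by
      rw [h]
      exact decide_eq_false (by norm_num)
    rw [hd, h]
    simp [signOf]
  · have hd : decide (twist x a = -1) = true := by
      rw [h]
      exact decide_eq_true rfl
    rw [hd, h]
    simp [signOf]

/-- A `Bool`-valued function with `(-1)^{ℓ(x)} = (-1)^{x·a}` is additive. -/
theorem dv_linear_of_signOf_eq_twist {n : ℕ} (a : Fin n → Bool) (la : (Fin n → Bool) → Bool)
    (hla : ∀ x, signOf (la x) = twist x a) (x v : Fin n → Bool) : la (bxor x v) = (la x ^^ la v) := by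
  apply dv_signOf_injective
  rw [signOf_xor, hla, hla, hla, twist_bxor_left]

/-- **Carlet moves fix the cubic form and shift the defect by `a ∧ b`.**  For additive `ℓ_a, ℓ_b`,
`D_v D_w (g ⊕ ℓ_a ℓ_b) = D_v D_w g ⊕ (ℓ_a(v) ℓ_b(w) ⊕ ℓ_a(w) ℓ_b(v))` pointwise — a constant shift, so singular
subspaces of `g` stay singular and the defect form changes by the alternating form `(a ∧ b)(v,w)`. -/
theorem dv_d2_carlet {n : ℕ} (g : (Fin n → Bool) → Bool) (a b : Fin n → Bool) (la lb : (Fin n → Bool) → Bool)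
    (hla : ∀ x, signOf (la x) = twist x a) (hlb : ∀ x, signOf (lb x) = twist x b) (v w x : Fin n → Bool) :
    ((g x ^^ (la x && lb x)) ^^ (g (bxor x v) ^^ (la (bxor x v) && lb (bxor x v))) ^^
        (g (bxor x w) ^^ (la (bxor x w) && lb (bxor x w))) ^^
          (g (bxor (bxor x v) w) ^^ (la (bxor (bxor x v) w) && lb (bxor (bxor x v) w)))) =
      ((g x ^^ g (bxor x v) ^^ g (bxor x w) ^^ g (bxor (bxor x v) w)) ^^ ((la v && lb w) ^^ (la w && lb v))) := by
  simp only [dv_linear_of_signOf_eq_twist a la hla, dv_linear_of_signOf_eq_twist b lb hlb]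
  have key : ∀ p0 p1 p2 p3 α β γ δ ε ζ : Bool,
      ((p0 ^^ (α && δ)) ^^ (p1 ^^ ((α ^^ β) && (δ ^^ ε))) ^^ (p2 ^^ ((α ^^ γ) && (δ ^^ ζ))) ^^
          (p3 ^^ ((α ^^ β ^^ γ) && (δ ^^ ε ^^ ζ)))) =
        ((p0 ^^ p1 ^^ p2 ^^ p3) ^^ ((β && ζ) ^^ (γ && ε))) := by
    decide
  exact key _ _ _ _ _ _ _ _ _ _

/-- **Walsh transform after a Carlet move** (Carlet, EUROCRYPT '93; *Boolean Functions for Cryptography and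
Coding Theory* (2021), §6.1): with `(-1)^{ℓ_a ℓ_b} = ½(1 + (-1)^{ℓ_a} + (-1)^{ℓ_b} - (-1)^{ℓ_a ⊕ ℓ_b})`,
`2 W_{g ⊕ ℓ_a ℓ_b}(u) = W_g(u) + W_g(u ⊕ a) + W_g(u ⊕ b) - W_g(u ⊕ a ⊕ b)`. -/
theorem dv_carlet_W {n : ℕ} (g : (Fin n → Bool) → Bool) (a b : Fin n → Bool) (la lb : (Fin n → Bool) → Bool)
    (hla : ∀ x, signOf (la x) = twist x a) (hlb : ∀ x, signOf (lb x) = twist x b) (u : Fin n → Bool) :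
    2 * DerivativeWalsh.W (fun x => signOf (g x ^^ (la x && lb x))) u =
      DerivativeWalsh.W (fun x => signOf (g x)) u + DerivativeWalsh.W (fun x => signOf (g x)) (bxor u a) +
        DerivativeWalsh.W (fun x => signOf (g x)) (bxor u b) -
          DerivativeWalsh.W (fun x => signOf (g x)) (bxor (bxor u a) b) := by
  unfold DerivativeWalsh.W
  rw [Finset.mul_sum, ← Finset.sum_add_distrib, ← Finset.sum_add_distrib, ← Finset.sum_sub_distrib]
  refine Finset.sum_congr rfl fun x _ => ?_
  simp only [signOf_xor, twist_bxor_right, ← hla, ← hlb]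
  linear_combination (signOf (g x) * twist x u) * dv_two_mul_signOf_and (la x) (lb x)

/-- **Carlet move** (mechanism (iii)).  If `W_g = c·(-1)^f` and `D_a D_b f ≡ 0`, then
`W_{g ⊕ ℓ_a ℓ_b} = c·(-1)^{f ⊕ (D_a f)(D_b f)}`: the moved function is again "bent with amplitude `c`", with dual
`f ⊕ (D_a f)(D_b f)`.  (With `c = 2^m` on `m + m` bits: `g ⊕ ℓ_a ℓ_b` is bent with that dual.) -/
theorem dv_carlet_move {n : ℕ} (f g : (Fin n → Bool) → Bool) (c : ℝ)
    (hW : ∀ u, DerivativeWalsh.W (fun x => signOf (g x)) u = c * signOf (f u)) (a b : Fin n → Bool)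
    (la lb : (Fin n → Bool) → Bool) (hla : ∀ x, signOf (la x) = twist x a) (hlb : ∀ x, signOf (lb x) = twist x b)
    (hab : ∀ u, (f u ^^ f (bxor u a) ^^ f (bxor u b) ^^ f (bxor (bxor u a) b)) = false) (u : Fin n → Bool) :
    DerivativeWalsh.W (fun x => signOf (g x ^^ (la x && lb x))) u =
      c * signOf (f u ^^ ((f u ^^ f (bxor u a)) && (f u ^^ f (bxor u b)))) := by
  have key := dv_carlet_W g a b la lb hla hlb u
  have hs4 : ∀ p q r s : Bool, (p ^^ q ^^ r ^^ s) = false → signOf s = signOf p * signOf q * signOf r := by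
    intro p q r s
    cases p <;> cases q <;> cases r <;> cases s <;> simp [signOf]
  rw [hW, hW, hW, hW, hs4 _ _ _ _ (hab u)] at key
  linear_combination (1 / 2 : ℝ) * key + (c / 2) * dv_carlet_signs (f u) (f (bxor u a)) (f (bxor u b))

/-- **Carlet move, converse.**  If `W_g = c·(-1)^f` with `c ≠ 0` and the moved function `g ⊕ ℓ_a ℓ_b` has
`W(u)² = c²` at some `u`, then `D_a D_b f (u) = 0` (otherwise `2 W(u) = c·(±4)` or `0`).  So `g ⊕ ℓ_a ℓ_b` is bent
iff `D_a D_b f ≡ 0`. -/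
theorem dv_carlet_converse {n : ℕ} (f g : (Fin n → Bool) → Bool) (c : ℝ) (hc : c ≠ 0)
    (hW : ∀ u, DerivativeWalsh.W (fun x => signOf (g x)) u = c * signOf (f u)) (a b : Fin n → Bool)
    (la lb : (Fin n → Bool) → Bool) (hla : ∀ x, signOf (la x) = twist x a) (hlb : ∀ x, signOf (lb x) = twist x b)
    (u : Fin n → Bool) (hbent : DerivativeWalsh.W (fun x => signOf (g x ^^ (la x && lb x))) u ^ 2 = c ^ 2) :
    (f u ^^ f (bxor u a) ^^ f (bxor u b) ^^ f (bxor (bxor u a) b)) = false := by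
  have key := dv_carlet_W g a b la lb hla hlb u
  rw [hW, hW, hW, hW] at key
  by_contra hne
  have hodd : signOf (f (bxor (bxor u a) b)) =
      -(signOf (f u) * signOf (f (bxor u a)) * signOf (f (bxor u b))) := by
    revert hne
    cases f u <;> cases f (bxor u a) <;> cases f (bxor u b) <;> cases f (bxor (bxor u a) b) <;> norm_num [signOf]
  rw [hodd] at key
  have hsq : (2 * DerivativeWalsh.W (fun x => signOf (g x ^^ (la x && lb x))) u) ^ 2 = 4 * c ^ 2 := by
    rw [mul_pow, hbent]
    norm_num
  rw [key] at hsq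
  have hpm : ∀ p : Bool, signOf p = 1 ∨ signOf p = -1 := fun p => by cases p <;> simp [signOf]
  have hb : (signOf (f u) + signOf (f (bxor u a)) + signOf (f (bxor u b)) +
      signOf (f u) * signOf (f (bxor u a)) * signOf (f (bxor u b))) ^ 2 - 4 ≠ 0 := by
    rcases hpm (f u) with h0 | h0 <;> rcases hpm (f (bxor u a)) with h1 | h1 <;>
      rcases hpm (f (bxor u b)) with h2 | h2 <;> rw [h0, h1, h2] <;> norm_num
  have hprod : c ^ 2 * ((signOf (f u) + signOf (f (bxor u a)) + signOf (f (bxor u b)) +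
      signOf (f u) * signOf (f (bxor u a)) * signOf (f (bxor u b))) ^ 2 - 4) = 0 := by
    linear_combination hsq
  rcases mul_eq_zero.1 hprod with h | h
  · exact hc ((pow_eq_zero_iff two_ne_zero).1 h)
  · exact hb h


/-- **Registered sub-goal `stub_defect_vanishing_carlet_move`** of the stub (= `dv_carlet_move` with `c = 2^m`): for
`g` bent with dual `f` on `m + m` bits and `D_a D_b f ≡ 0`, the Carlet move `g ⊕ ℓ_a ℓ_b` is bent with dual
`f ⊕ (D_a f)(D_b f)`. -/
theorem stub_defect_vanishing_carlet_move :
    ∀ (m : ℕ) (f g : (Fin (m + m) → Bool) → Bool),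
      (∀ u : Fin (m + m) → Bool, DerivativeWalsh.W (fun x => signOf (g x)) u = (2 : ℝ) ^ m * signOf (f u)) →
      ∀ (a b : Fin (m + m) → Bool) (la lb : (Fin (m + m) → Bool) → Bool),
        (∀ x, signOf (la x) = twist x a) → (∀ x, signOf (lb x) = twist x b) →
        (∀ u : Fin (m + m) → Bool, (f u ^^ f (bxor u a) ^^ f (bxor u b) ^^ f (bxor (bxor u a) b)) = false) →
        ∀ u : Fin (m + m) → Bool,
          DerivativeWalsh.W (fun x => signOf (g x ^^ (la x && lb x))) u =
            (2 : ℝ) ^ m * signOf (f u ^^ ((f u ^^ f (bxor u a)) && (f u ^^ f (bxor u b)))) :=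
  fun m f g hW a b la lb hla hlb hab u => dv_carlet_move f g ((2 : ℝ) ^ m) hW a b la lb hla hlb hab u

end Summit.QuantumAdvantage.QuantumAdvantage.Theorems.CubicForrelation.ExactPairsMaioranaMcFarland
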